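import Mathlib
import Summits.Ventures.PercRepro2.Defs
import Summits.Ventures.PercRepro2.Graph
import Summits.Ventures.PercRepro2.OneColourSwitch
import Summits.Ventures.PercRepro2.RegionHubSign
import Summits.Ventures.PercRepro2.SideSwitch
import Summits.Ventures.PercRepro2.TermSwitchDefs
import Summits.Ventures.PercRepro2.M9NoPocketDefs
import Summits.Ventures.PercRepro2.M9GeneralDSplit
import Summits.Ventures.PercRepro2.M9LinkedHD
import Summits.Ventures.PercRepro2.M9FourParts
import Summits.Ventures.PercRepro2.M9ReachedSum
import Summits.Ventures.PercRepro2.M9ReachedK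
import Summits.Ventures.PercRepro2.M9PsiOneDefs
import Summits.Ventures.PercRepro2.M9PsiOneWorlds
import Summits.Ventures.PercRepro2.M9PsiOneWorldsM
import Summits.Ventures.PercRepro2.M9PsiOneSurvive
import Summits.Ventures.PercRepro2.M9PsiOneLink
import Summits.Ventures.PercRepro2.M9PsiOneLinkW
import Summits.Ventures.PercRepro2.M9PsiOneSigma
import Summits.Ventures.PercRepro2.M9PsiOneInj
import Summits.Ventures.PercRepro2.M9PsiOneSum

/-!
# The single-`d` statement with the payment built in: the reduction (REST′) (blind cell
PercRepro2, p3 g31, 2026-08-28; `proofs/P3-PAYMENT.md` §6)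

The positive doubly-reached points `exPlusPos` (`σ_pq = σ_rs = +1`) are cancelled EXACTLY by
their partners (`sigma_mul_psiOne_of_pos`: `σ_pq σ_rs (Ψ₁ ω) = −1`), which are one-sided
`K`-points (`kOnlySet`).  With `dSignSum = N + 2·kOnlySum + exSum` (`M9ReachedK`) and
`exSum = 2 (#exPlusPos − #exPlusNeg)`:
  `dSignSum = N + 2·(Σ_{kOnlySet ∖ Ψ₁(exPlusPos)} σ_pq σ_rs − #exPlusNeg)`
(`dSignSum_eq_rest`), so **the single-`d` statement follows from (REST′)
`Σ_{kOnlySet ∖ Ψ₁(exPlusPos)} σ_pq σ_rs ≤ #exPlusNeg`** (`dSignSum_nonpos_of_rest_le_neg`) —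
the one-sided `K`-points not reserved for the positive doubly-reached points, against the
negative doubly-reached points.  Own work; std axioms.
-/

namespace Summit.Ventures.PercRepro2

namespace NoPocket

open Finset Classical RegionHub OneColourSwitch SideSwitch TermSwitch

variable {V : Type*} {E : Type*}

section Rest

variable [Fintype V] [DecidableEq V] [Fintype E] [DecidableEq E] {ends : E → Sym2 V}
  {p q r s d : V}

/-- The positive doubly-reached points: `exPlusSet` with `σ_pq = 1`. -/
noncomputable def exPlusPos (ends : E → Sym2 V) (p q r s d : V) : Finset (Config E) :=
  (exPlusSet ends p q r s d).filter (fun ω => sigma ends ω p q = 1)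

/-- The negative doubly-reached points: `exPlusSet` with `σ_pq = −1`. -/
noncomputable def exPlusNeg (ends : E → Sym2 V) (p q r s d : V) : Finset (Config E) :=
  (exPlusSet ends p q r s d).filter (fun ω => sigma ends ω p q = -1)

/-- The one-sided `K`-points of `Sep ∧ DOne(d)`. -/
noncomputable def kOnlySet (ends : E → Sym2 V) (p q r s d : V) : Finset (Config E) :=
  univ.filter (fun ω => sep2 ends p q r s ω ∧ DOne ends r s d ω ∧
    (d ∈ K2 ends r s ω ∧ d ∉ M2 ends r s ω))

omit [Fintype V] [DecidableEq V] [Fintype E] [DecidableEq E] in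
/-- `σ ≥ −1`. -/
lemma sigma_ge_neg_one (ω : Config E) (a b : V) : -1 ≤ sigma ends ω a b := by
  unfold sigma; split_ifs <;> norm_num

omit [Fintype V] [DecidableEq V] [Fintype E] [DecidableEq E] in
/-- `σ ≤ 1`. -/
lemma sigma_le_one (ω : Config E) (a b : V) : sigma ends ω a b ≤ 1 := by
  unfold sigma; split_ifs <;> norm_num

omit [Fintype V] [DecidableEq V] in
/-- `kOnlySum` is the sum over `kOnlySet`. -/
lemma kOnlySum_eq_sum_kOnlySet :
    kOnlySum ends p q r s d = ∑ ω ∈ kOnlySet ends p q r s d, sigma ends ω p q * sigma ends ω r s := by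
  unfold kOnlySum kOnlySet
  rw [Finset.sum_filter]

omit [Fintype V] [DecidableEq V] in
/-- **A positive doubly-reached point and its partner cancel exactly.** -/
theorem sigma_mul_psiOne_of_pos (hrs : ∀ e, ends e ≠ s(r, s)) {ω : Config E}
    (hω : ω ∈ exPlusPos ends p q r s d) :
    sigma ends (psiOne ends r s d ω) p q * sigma ends (psiOne ends r s d ω) r s = -1 := by
  obtain ⟨hω, hpq⟩ := Finset.mem_filter.1 hω
  obtain ⟨h, hY, _⟩ := mem_exPlusSet.1 hω
  rw [sigma_rs_psiOne h hrs hY, mul_one]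
  have h1 := sigma_psiOne_le_neg h (p := p) (q := q)
  have h2 := sigma_ge_neg_one (ends := ends) (psiOne ends r s d ω) p q
  rw [hpq] at h1
  omega

omit [Fintype V] [DecidableEq V] in
/-- The partners of the positive doubly-reached points are one-sided `K`-points. -/
lemma image_pos_subset_kOnlySet :
    (exPlusPos ends p q r s d).image (psiOne ends r s d) ⊆ kOnlySet ends p q r s d := by
  intro ω' hω'
  obtain ⟨ω, hω, rfl⟩ := Finset.mem_image.1 hω'
  obtain ⟨hω, _⟩ := Finset.mem_filter.1 hω
  obtain ⟨h1, h2, h3, h4⟩ := psiOne_mem_kOnly hω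
  exact Finset.mem_filter.2 ⟨Finset.mem_univ _, h1, h2, h3, h4⟩

omit [Fintype V] [DecidableEq V] in
/-- `Ψ₁` is injective on the positive doubly-reached points. -/
lemma psiOne_injOn_pos (hrs : ∀ e, ends e ≠ s(r, s)) :
    Set.InjOn (psiOne ends r s d) ↑(exPlusPos ends p q r s d) :=
  (psiOne_injOn_exPlus (p := p) (q := q) (d := d) hrs).mono
    (fun _ hω => Finset.mem_coe.2 (Finset.mem_filter.1 (Finset.mem_coe.1 hω)).1)

omit [Fintype V] [DecidableEq V] in
/-- The sum over the partners of the positive points is `−#exPlusPos`. -/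
lemma sum_image_pos (hrs : ∀ e, ends e ≠ s(r, s)) :
    ∑ ω ∈ (exPlusPos ends p q r s d).image (psiOne ends r s d), sigma ends ω p q * sigma ends ω r s =
      -((exPlusPos ends p q r s d).card : ℤ) := by
  rw [Finset.sum_image (psiOne_injOn_pos hrs)]
  rw [Finset.sum_congr rfl (fun ω hω => sigma_mul_psiOne_of_pos hrs hω), Finset.sum_const,
    nsmul_eq_mul, mul_neg, mul_one]

omit [Fintype V] [DecidableEq V] in
/-- **`Σ_{exPlusSet} σ_pq = #exPlusPos − #exPlusNeg`.** -/
lemma sum_exPlus_eq_card :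
    ∑ ω ∈ exPlusSet ends p q r s d, sigma ends ω p q =
      ((exPlusPos ends p q r s d).card : ℤ) - ((exPlusNeg ends p q r s d).card : ℤ) := by
  have key : ∀ ω ∈ exPlusSet ends p q r s d, sigma ends ω p q =
      (if sigma ends ω p q = 1 then (1 : ℤ) else 0) - (if sigma ends ω p q = -1 then (1 : ℤ) else 0) := by
    intro ω _
    have h1 := sigma_ge_neg_one (ends := ends) ω p q
    have h2 := sigma_le_one (ends := ends) ω p q
    rcases (by omega : sigma ends ω p q = 1 ∨ sigma ends ω p q = 0 ∨ sigma ends ω p q = -1) with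
      h | h | h <;> simp [h]
  rw [Finset.sum_congr rfl key, Finset.sum_sub_distrib, ← Finset.sum_filter, ← Finset.sum_filter]
  simp [exPlusPos, exPlusNeg]

omit [Fintype V] [DecidableEq V] in
/-- **`dSignSum = N + 2·(Σ_{kOnlySet ∖ Ψ₁(exPlusPos)} σ_pq σ_rs − #exPlusNeg)`** (no edge at `d`
to `r, s`, no `r–s` edge). -/
theorem dSignSum_eq_rest (hT : ∀ e, ends e ≠ s(d, r) ∧ ends e ≠ s(d, s)) (hr : d ≠ r) (hs : d ≠ s)
    (hrs : r ≠ s) (hrs' : ∀ e, ends e ≠ s(r, s)) :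
    dSignSum ends p q r s d = unreachedSum ends p q r s d +
      2 * ((∑ ω ∈ kOnlySet ends p q r s d \ (exPlusPos ends p q r s d).image (psiOne ends r s d),
        sigma ends ω p q * sigma ends ω r s) - ((exPlusNeg ends p q r s d).card : ℤ)) := by
  have hsplit := Finset.sum_sdiff (f := fun ω => sigma ends ω p q * sigma ends ω r s)
    (image_pos_subset_kOnlySet (ends := ends) (p := p) (q := q) (r := r) (s := s) (d := d))
  rw [sum_image_pos hrs'] at hsplit
  have hk := kOnlySum_eq_sum_kOnlySet (ends := ends) (p := p) (q := q) (r := r) (s := s) (d := d)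
  have hd := dSignSum_eq_four_status (ends := ends) (p := p) (q := q) (r := r) (s := s) (d := d)
  rw [mOnlySum_eq_kOnlySum, exSum_eq_two_mul_exPlus hT hr hs hrs, sum_exPlus_eq_card] at hd
  rw [hd, hk, ← hsplit]
  ring

/-- **The single-`d` statement from (REST′)**: `Σ_{kOnlySet ∖ Ψ₁(exPlusPos)} σ_pq σ_rs ≤ #exPlusNeg`
(no edge at `d` to `r, s`, no `r–s` edge). -/
theorem dSignSum_nonpos_of_rest_le_neg (hT : ∀ e, ends e ≠ s(d, r) ∧ ends e ≠ s(d, s))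
    (hr : d ≠ r) (hs : d ≠ s) (hrs : r ≠ s) (hrs' : ∀ e, ends e ≠ s(r, s))
    (hrest : (∑ ω ∈ kOnlySet ends p q r s d \ (exPlusPos ends p q r s d).image (psiOne ends r s d),
        sigma ends ω p q * sigma ends ω r s) ≤ ((exPlusNeg ends p q r s d).card : ℤ)) :
    dSignSum ends p q r s d ≤ 0 := by
  rw [dSignSum_eq_rest hT hr hs hrs hrs']
  have hN := unreachedSum_nonpos (ends := ends) (p := p) (q := q) (r := r) (s := s) (d := d)
  linarith

end Rest

end NoPocket

end Summit.Ventures.PercRepro2
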